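import Mathlib
import HarnessLib
import Literature.Analysis.FluidPDE.SelfSimilar
import Literature.Analysis.FluidPDE.LocalTypeI
import Literature.Analysis.FluidPDE.VectorCalculus
import Literature.Analysis.FluidPDE.OseenMildUniqueness
import Literature.Analysis.Fourier.TitchmarshPaleyWiener
import Literature.Analysis.UnboundedOperators.HeatKernel
import Summits.NavierStokesRegularity.NavierStokesRegularity.Theorems.LocalSineTubeDoorProfileAlignedWindowRigidityAncient
import Summits.NavierStokesRegularity.NavierStokesRegularity.Theorems.PoloidalWindowDoorPoloidalWindowRigiditySubparabolicGradient
import Summits.NavierStokesRegularity.NavierStokesRegularity.Theorems.PoloidalWindowDoorPoloidalWindowRigidityLinePairing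
import Summits.NavierStokesRegularity.NavierStokesRegularity.Theorems.PoloidalWindowDoorPoloidalWindowRigidityLineBandLimited

/-!
# K2 `PoloidalWindowRigidity` (stmt-NavierStokesRegularity-19708) — HORIZONTAL EXPONENTIAL TYPE ON A WINDOW ALONE RULES OUT A
# SINGULAR APEX (the minimal-hypothesis form of the proof of the rung `stub_expTypeTH`, line `entire_slices`)

Seat ns-es-p1 g2 (`--supports stmt-NavierStokesRegularity-19708 --as helper`).  The landed rung
`…Theorems.PoloidalWindowDoorPoloidalWindowRigidityStubExpTypeTH.stub_expTypeTH` (p609463) carries the full binder of `mixed_type`'s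
`stub_hyperbolicTH` (poloidality, ND pins, (TV)-pin, twist, hyperbolicity, (TH) slope law), but its proof uses none of them.  This file
records the statement actually proved, for re-use by other lines and windows (e.g. `string_shells`, thick windows, or any future line
that can produce an exponential-type bound on some open set):

* `not_backwardSingular_of_horizontalExpType` — Type-I class profile (rate, continuity on the open slab, unit-viscosity Oseen-mild,
  divergence-free slices) + a nonempty open space–time set `W` in the slab on which the horizontal restrictions
  `p ↦ v(t, y + (p₀, p₁, 0))` obey a uniform exponential-type bound `‖Dⁿ(·)(0)‖ ≤ A bⁿ` ⇒ `¬ IsBackwardSingularPoint v 0`;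
* `not_backwardSingular_of_lineExpType` — the same with the weaker, one-directional clause: a uniform bound
  `|dⁿ/dsⁿ v_i(t, y + s e₀)|_{s=0}| ≤ A bⁿ` for the line restrictions along `e₀ = (1,0,0)` at the points of `W`.

Chain: (D) `…LineBandLimited.hasFourierSupportIn_of_iteratedDeriv_bound` / `…hasFourierSupportIn_line_of_taylorBound` → (C)
`…LinePairing.hasFourierSupportIn_line_of_open` → (B) `…LineBandLimited.norm_fderiv_apply_le_of_lineBandLimited_typeI` → (A)
`…SubparabolicGradient.not_backwardSingular_of_fderiv_apply_bound`.

WHAT THIS IS NOT: not a claim about Navier–Stokes regularity and not the crux — a class-level Liouville-type endgame («band-limited in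
one horizontal direction on some window ⇒ regular apex»); bears_on LADDER-NS N0 via crux K2 = stmt-19708.  No summit statement is proved.
-/

noncomputable section

-- the summit and its single sub-problem share the name (CONVENTIONS §1), as in every Theorems file
set_option linter.dupNamespace false

namespace Summit.NavierStokesRegularity.NavierStokesRegularity.Theorems.PoloidalWindowDoorPoloidalWindowRigidityHorizontalExpType

open Set Function Filter MeasureTheory Metric Topology
open scoped Real
open Literature.Analysis Literature.Analysis.FluidPDE Literature.Analysis.Fourier
open Summit.NavierStokesRegularity.NavierStokesRegularity.Theorems.LocalSineTubeDoorProfileAlignedWindowRigidityAncient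
open Summit.NavierStokesRegularity.NavierStokesRegularity.Theorems.PoloidalWindowDoorPoloidalWindowRigiditySubparabolicGradient
open Summit.NavierStokesRegularity.NavierStokesRegularity.Theorems.PoloidalWindowDoorPoloidalWindowRigidityLinePairing
open Summit.NavierStokesRegularity.NavierStokesRegularity.Theorems.PoloidalWindowDoorPoloidalWindowRigidityLineBandLimited

variable {C : ℝ} {v : ℝ → EuclideanSpace ℝ (Fin 3) → EuclideanSpace ℝ (Fin 3)}

/-- **Exponential type along ONE horizontal line direction on a window ⇒ regular apex.**  If `v` is a profile of the Type-I class
and on a nonempty open `W ⊆ (−∞,0) × ℝ³` every component of every line restriction `g(s) = v_i(t, y + s e₀)` (`(t,y) ∈ W`,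
`e₀ = (1,0,0)`) is real-analytically extendable with `|g⁽ⁿ⁾(0)| ≤ A bⁿ` (uniform `A`, `b ≥ 0`), then `(0,0)` is not a backward
singular point of `v`. -/
theorem not_backwardSingular_of_lineExpType (hrate : HasTypeITimeDecay C v)
    (hcont : ContinuousOn (uncurry v) (Iio (0 : ℝ) ×ˢ univ))
    (hmild : ∀ s t : ℝ, s < t → t < 0 → ∀ x,
      v t x = UnboundedOperators.heatExtension (v s) (t - s) x - oseenDuhamel 1 s v v t x)
    (hdiv : ∀ t < 0, VectorCalculus.IsDivFree (v t))
    {W : Set (ℝ × EuclideanSpace ℝ (Fin 3))} (hW : IsOpen W) (hWne : W.Nonempty) (hWs : W ⊆ Iio (0 : ℝ) ×ˢ univ)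
    {A b : ℝ} (hb : 0 ≤ b)
    (hA : ∀ z ∈ W, ∀ (i : Fin 3) (n : ℕ),
      |iteratedDeriv n (fun s : ℝ => v z.1 (z.2 + s • EuclideanSpace.single 0 1) i) 0| ≤ A * b ^ n) :
    ¬ IsBackwardSingularPoint v 0 := by
  have hbdd := bdd_of_hasTypeITimeDecay hrate
  set e₀ : EuclideanSpace ℝ (Fin 3) := EuclideanSpace.single 0 1 with he₀
  -- (D) each line restriction at a window point is band-limited
  have hD : ∀ z ∈ W, ∀ i : Fin 3,
      HasFourierSupportIn (fun s : ℝ => ((v z.1 (z.2 + s • e₀) i : ℝ) : ℂ)) (Icc (-(b / (2 * π))) (b / (2 * π))) := by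
    intro z hz i
    have ht : z.1 < 0 := (mem_prod.1 (hWs hz)).1
    have hAn : AnalyticOnNhd ℝ (v z.1) univ := analyticOnNhd_slice hcont hbdd hmild ht
    obtain ⟨Bt, hBt⟩ := hbdd (-(z.1 / 2)) (by linarith)
    have hgan : AnalyticOnNhd ℝ (fun s : ℝ => v z.1 (z.2 + s • e₀) i) univ := fun s _ =>
      ((EuclideanSpace.proj (𝕜 := ℝ) i : EuclideanSpace ℝ (Fin 3) →L[ℝ] ℝ).analyticAt _).comp
        ((hAn _ (mem_univ _)).comp (analyticAt_line z.2 e₀ s))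
    have hgM : ∀ x : ℝ, |v z.1 (z.2 + x • e₀) i| ≤ Bt := fun x => by
      have h := PiLp.norm_apply_le (v z.1 (z.2 + x • e₀)) i
      rw [Real.norm_eq_abs] at h
      exact h.trans (hBt z.1 (by linarith) _)
    exact hasFourierSupportIn_of_iteratedDeriv_bound hgan hb (hA z hz i) hgM
  -- (C) propagation, (B) Bernstein, (A) endgame
  have hC : ∀ t < 0, ∀ (y : EuclideanSpace ℝ (Fin 3)) (i : Fin 3),
      HasFourierSupportIn (fun s : ℝ => ((v t (y + s • e₀) i : ℝ) : ℂ)) (Icc (-(b / (2 * π))) (b / (2 * π))) :=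
    fun t ht y i => hasFourierSupportIn_line_of_open hcont hbdd hmild e₀ i _ hW hWne hWs (fun z hz => hD z hz i) t ht y
  have hB := norm_fderiv_apply_le_of_lineBandLimited_typeI hrate hcont hmild (e := e₀) (B := b / (2 * π))
    (by positivity) hC
  have he₀0 : e₀ ≠ 0 := by
    intro h
    have h0 := congrArg (fun w : EuclideanSpace ℝ (Fin 3) => w 0) h
    simp [he₀] at h0
  exact not_backwardSingular_of_fderiv_apply_bound hrate hcont hmild hdiv he₀0 hB

/-- **Horizontal exponential type on a window ⇒ regular apex** (the clause of `stub_expTypeTH`, nothing else): a profile of the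
Type-I class with a nonempty open `W ⊆ (−∞,0) × ℝ³` at whose points the horizontal restrictions `p ↦ v(t, y + (p₀, p₁, 0))`
obey `‖Dⁿ(·)(0)‖ ≤ A bⁿ` for all `n` (uniform `A`, `b ≥ 0`) is not backward-singular at `(0,0)`. -/
theorem not_backwardSingular_of_horizontalExpType (hrate : HasTypeITimeDecay C v)
    (hcont : ContinuousOn (uncurry v) (Iio (0 : ℝ) ×ˢ univ))
    (hmild : ∀ s t : ℝ, s < t → t < 0 → ∀ x,
      v t x = UnboundedOperators.heatExtension (v s) (t - s) x - oseenDuhamel 1 s v v t x)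
    (hdiv : ∀ t < 0, VectorCalculus.IsDivFree (v t))
    {W : Set (ℝ × EuclideanSpace ℝ (Fin 3))} (hW : IsOpen W) (hWne : W.Nonempty) (hWs : W ⊆ Iio (0 : ℝ) ×ˢ univ)
    {A b : ℝ} (hb : 0 ≤ b)
    (hA : ∀ z ∈ W, ∀ n : ℕ, ‖iteratedFDeriv ℝ n (fun p : EuclideanSpace ℝ (Fin 2) =>
        v z.1 (z.2 + (EuclideanSpace.single 0 (p 0) + EuclideanSpace.single 1 (p 1)))) 0‖ ≤ A * b ^ n) :
    ¬ IsBackwardSingularPoint v 0 := by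
  have hbdd := bdd_of_hasTypeITimeDecay hrate
  set e₀ : EuclideanSpace ℝ (Fin 3) := EuclideanSpace.single 0 1 with he₀
  have hD : ∀ z ∈ W, ∀ i : Fin 3,
      HasFourierSupportIn (fun s : ℝ => ((v z.1 (z.2 + s • e₀) i : ℝ) : ℂ)) (Icc (-(b / (2 * π))) (b / (2 * π))) :=
    fun z hz i => hasFourierSupportIn_line_of_taylorBound hcont hbdd hmild (mem_prod.1 (hWs hz)).1 z.2 hb (hA z hz) i
  have hC : ∀ t < 0, ∀ (y : EuclideanSpace ℝ (Fin 3)) (i : Fin 3),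
      HasFourierSupportIn (fun s : ℝ => ((v t (y + s • e₀) i : ℝ) : ℂ)) (Icc (-(b / (2 * π))) (b / (2 * π))) :=
    fun t ht y i => hasFourierSupportIn_line_of_open hcont hbdd hmild e₀ i _ hW hWne hWs (fun z hz => hD z hz i) t ht y
  have hB := norm_fderiv_apply_le_of_lineBandLimited_typeI hrate hcont hmild (e := e₀) (B := b / (2 * π))
    (by positivity) hC
  have he₀0 : e₀ ≠ 0 := by
    intro h
    have h0 := congrArg (fun w : EuclideanSpace ℝ (Fin 3) => w 0) h
    simp [he₀] at h0
  exact not_backwardSingular_of_fderiv_apply_bound hrate hcont hmild hdiv he₀0 hB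

end Summit.NavierStokesRegularity.NavierStokesRegularity.Theorems.PoloidalWindowDoorPoloidalWindowRigidityHorizontalExpType

end
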